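import Summits.QuantumFields.GaugeBoot.TwistedTraceLoops
import Summits.QuantumFields.GaugeBoot.WordLoopZdLimit
import HarnessLib

/-!
# `ℤ^d`: Wilson loops as complex observables, twisted traces of closed-word holonomies, paths between sites (gauge-boot, FFT/ℤ^d 1/3)

HONEST FRAMING (cell `pub-gaugeboot`, page 1 of every file): the venture produces certified bounds
on lattice expectations at stated coupling, gauge group, dimension and torus size; NOT a mass gap,
NOT a continuum limit, NOT a string tension; NOT Yang–Mills-summit-bearing (barriers
`FixedCouplingUltralocality`, `PerturbativeInvisibility`). Bookkeeping on the infinite lattice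
`ℤ^d` (configurations `LGConfig d G`); no number is certified. First of three modules carrying the
lane's FIRST FUNDAMENTAL THEOREM for lattice gauge invariants (torus: `WilsonLoopsGenerateInvariants`)
over to `ℤ^d`, where the lane's DLR / infinite-volume bootstrap statements live.

## Content (`ℤ^d`, any topological group `G`, `r : LatticeRep G`)

* `wordHolonomyZd_gaugeTransformZd` — gauge covariance of `ℤ^d` word holonomies,
  `hol_x(w)(U^γ) = γ(x) hol_x(w)(U) γ(end)⁻¹`.
* `loopCZd r x w`, `lineCZd` — complex Wilson loops / line entries on `ℤ^d` as continuous
  observables; `loopAlgebraCZd r x` — the unital `ℂ`-algebra generated by the Wilson loops of the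
  closed words at `x`.
* ★★ `exists_mem_loopAlgebraCZd_twistTrace` — twisted traces of closed-word holonomies are
  multi-trace Wilson loops (slot elimination, as on the torus).
* ★ `exists_wordZd_endpointZd` — `ℤ^d` is connected by lattice words (runs `±e_i` along the axes).

References: B. Durhuus, Lett. Math. Phys. 4 (1980) 515–522; A. Sengupta, Proc. AMS 121 (1994)
897–905. Folklore.
-/

noncomputable section

namespace Summit.QuantumFields.GaugeBoot

open Matrix Finset TensorFFT
open Literature.MathematicalPhysics.QuantumFieldTheory (LatticeRep)
open Literature.MathematicalPhysics.QuantumLattice (LGConfig ZdEdge gaugeTransformZd IsZdGaugeInvariant)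
open Literature.Probability.LatticeModels (Site)

variable {d : ℕ} {G : Type*} [Group G]

/-! ## Gauge covariance and connectivity on `ℤ^d` -/

/-- **Gauge covariance of `ℤ^d` word holonomies**: `hol_x(w)(U^γ) = γ(x) hol_x(w)(U) γ(end)⁻¹`. -/
theorem wordHolonomyZd_gaugeTransformZd (γ : Site d → G) (U : LGConfig d G) :
    ∀ (x : Site d) (w : Word d), wordHolonomyZd (gaugeTransformZd γ U) x w =
      γ x * wordHolonomyZd U x w * (γ (Word.endpointZd x w))⁻¹
  | x, [] => by simp
  | x, s :: w => by
    rw [wordHolonomyZd_cons, wordHolonomyZd_cons, Word.endpointZd_cons,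
      wordHolonomyZd_gaugeTransformZd γ U (s.applyZd x) w]
    cases s with
    | fwd μ => simp only [stepHolonomyZd, gaugeTransformZd, Step.applyZd]; group
    | bwd μ =>
      simp only [stepHolonomyZd, gaugeTransformZd, Step.applyZd, sub_add_cancel]
      group

/-- The reversed word from its endpoint carries the inverse holonomy (endpoint form, `ℤ^d`). -/
theorem wordHolonomyZd_reverse_of_endpoint (U : LGConfig d G) {x y : Site d} {w : Word d}
    (h : Word.endpointZd x w = y) : wordHolonomyZd U y w.reverse = (wordHolonomyZd U x w)⁻¹ := by
  subst h
  exact wordHolonomyZd_reverse U x w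

omit [Group G] in
/-- Straight runs on `ℤ^d`: `n` forward steps along axis `i` end at `x + n e_i`. -/
theorem endpointZd_replicate_fwd (x : Site d) (i : Fin d) (n : ℕ) :
    Word.endpointZd x (List.replicate n (Step.fwd i)) = x + Pi.single i (n : ℤ) := by
  induction n generalizing x with
  | zero => simp
  | succ n ih =>
    rw [List.replicate_succ, Word.endpointZd_cons, ih]
    simp only [Step.applyZd, Nat.cast_succ]
    rw [add_assoc, ← Pi.single_add, add_comm (1 : ℤ)]

omit [Group G] in
/-- Straight runs on `ℤ^d`: `n` backward steps along axis `i` end at `x - n e_i`. -/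
theorem endpointZd_replicate_bwd (x : Site d) (i : Fin d) (n : ℕ) :
    Word.endpointZd x (List.replicate n (Step.bwd i)) = x - Pi.single i (n : ℤ) := by
  induction n generalizing x with
  | zero => simp
  | succ n ih =>
    rw [List.replicate_succ, Word.endpointZd_cons, ih]
    simp only [Step.applyZd, Nat.cast_succ]
    rw [sub_sub, ← Pi.single_add, add_comm (1 : ℤ)]

omit [Group G] in
/-- A run of `z ∈ ℤ` steps along axis `i` (forward then backward part) ends at `x + z e_i`. -/
theorem endpointZd_axisRun (x : Site d) (i : Fin d) (z : ℤ) :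
    Word.endpointZd x (List.replicate z.toNat (Step.fwd i) ++ List.replicate (-z).toNat (Step.bwd i)) =
      x + Pi.single i z := by
  rw [Word.endpointZd_append, endpointZd_replicate_fwd, endpointZd_replicate_bwd, add_sub_assoc,
    ← Pi.single_sub, Int.toNat_sub_toNat_neg]

omit [Group G] in
/-- ★ **`ℤ^d` is connected by lattice words**: for all sites `x, y` there is a word from `x` to `y`. -/
theorem exists_wordZd_endpointZd (x y : Site d) : ∃ γ : Word d, Word.endpointZd x γ = y := by
  classical
  suffices h : ∀ (l : List (Fin d)), l.Nodup → ∀ (v : Site d), ∃ γ : Word d, ∀ x : Site d,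
      Word.endpointZd x γ = x + ∑ i ∈ l.toFinset, Pi.single i (v i) by
    obtain ⟨γ, hγ⟩ := h (Finset.univ : Finset (Fin d)).toList (Finset.nodup_toList _) (y - x)
    refine ⟨γ, ?_⟩
    rw [hγ x, Finset.toList_toFinset, Finset.univ_sum_single (y - x)]
    abel
  intro l hl v
  induction l with
  | nil => exact ⟨[], fun x => by simp⟩
  | cons i l ih =>
    obtain ⟨γ, hγ⟩ := ih (List.nodup_cons.1 hl).2
    refine ⟨(List.replicate (v i).toNat (Step.fwd i) ++ List.replicate (-(v i)).toNat (Step.bwd i)) ++ γ,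
      fun x => ?_⟩
    rw [Word.endpointZd_append, endpointZd_axisRun, hγ, List.toFinset_cons,
      Finset.sum_insert (fun h => (List.nodup_cons.1 hl).1 (List.mem_toFinset.1 h)), add_assoc]

/-! ## Wilson loops on `ℤ^d` as complex observables -/

section Loops

variable [TopologicalSpace G] [IsTopologicalGroup G] (r : LatticeRep G)

/-- **Complex Wilson line entry on `ℤ^d`** `U ↦ ρ(hol_x(w) U)_{ab}`. [folklore] -/
def lineCZd (x : Site d) (w : Word d) (a b : Fin r.N) : C(LGConfig d G, ℂ) :=
  ⟨fun U => r.ρ (wordHolonomyZd U x w) a b, (r.continuous.comp (continuous_wordHolonomyZd x w)).matrix_elem a b⟩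

/-- **Complex Wilson loop on `ℤ^d`** `U ↦ tr ρ(hol_x(w) U)`. [folklore] -/
def loopCZd (x : Site d) (w : Word d) : C(LGConfig d G, ℂ) :=
  ⟨fun U => (r.ρ (wordHolonomyZd U x w)).trace, (r.continuous.comp (continuous_wordHolonomyZd x w)).matrix_trace⟩

/-- `lineCZd` evaluated. -/
@[simp] theorem lineCZd_apply (x : Site d) (w : Word d) (a b : Fin r.N) (U : LGConfig d G) :
    lineCZd r x w a b U = r.ρ (wordHolonomyZd U x w) a b := rfl

/-- `loopCZd` evaluated. -/
@[simp] theorem loopCZd_apply (x : Site d) (w : Word d) (U : LGConfig d G) :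
    loopCZd r x w U = (r.ρ (wordHolonomyZd U x w)).trace := rfl

/-- **The (complex, multi-trace) Wilson loop algebra at `x` on `ℤ^d`**: generated by the Wilson
loops of the closed words at `x`. [folklore] -/
def loopAlgebraCZd (x : Site d) : Subalgebra ℂ C(LGConfig d G, ℂ) :=
  Algebra.adjoin ℂ {f | ∃ w : Word d, Word.endpointZd x w = x ∧ f = loopCZd r x w}

/-- Wilson loops of closed words are in the loop algebra. -/
theorem loopCZd_mem_loopAlgebraCZd (x : Site d) {w : Word d} (hw : Word.endpointZd x w = x) :
    loopCZd r x w ∈ loopAlgebraCZd (d := d) r x :=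
  Algebra.subset_adjoin ⟨w, hw, rfl⟩

omit [IsTopologicalGroup G] in
/-- `ρ(hol_x(u · v)) = ρ(hol_x u) ρ(hol_x v)` for `u` closed at `x` (`ℤ^d`). -/
theorem rho_wordHolonomyZd_append_of_closed (U : LGConfig d G) (x : Site d) {u : Word d}
    (hu : Word.endpointZd x u = x) (v : Word d) :
    r.ρ (wordHolonomyZd U x (u ++ v)) = r.ρ (wordHolonomyZd U x u) * r.ρ (wordHolonomyZd U x v) := by
  rw [wordHolonomyZd_append, hu, map_mul]

/-- ★★ **Twisted traces of closed-word holonomies on `ℤ^d` are multi-trace Wilson loops.** -/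
theorem exists_mem_loopAlgebraCZd_twistTrace (x : Site d) :
    ∀ (p : ℕ) (τ : Equiv.Perm (Fin p)) (w : Fin p → Word d), (∀ k, Word.endpointZd x (w k) = x) →
      ∃ F ∈ loopAlgebraCZd (d := d) r x,
        ∀ U : LGConfig d G, F U = twistTrace τ (fun k => r.ρ (wordHolonomyZd U x (w k))) := by
  intro p
  induction p with
  | zero =>
    intro τ w _
    refine ⟨1, Subalgebra.one_mem _, fun U => ?_⟩
    rw [twistTrace_def, ContinuousMap.one_apply]
    simp
  | succ p ih =>
    intro τ w hw
    set e : Fin (p + 1) ≃ Option (Fin p) := finSuccEquiv p with he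
    set σ : Equiv.Perm (Option (Fin p)) := e.permCongr τ with hσ
    have key : ∀ U : LGConfig d G, twistTrace τ (fun k => r.ρ (wordHolonomyZd U x (w k))) =
        twistTrace σ (fun o => r.ρ (wordHolonomyZd U x (w (e.symm o)))) := fun U =>
      twistTrace_equiv e τ _
    rcases hnone : σ none with _ | a₀
    · obtain ⟨F', hF', hF'U⟩ := ih (Equiv.removeNone σ) (fun a => w (e.symm (some a))) (fun a => hw _)
      refine ⟨loopCZd r x (w (e.symm none)) * F',
        Subalgebra.mul_mem _ (loopCZd_mem_loopAlgebraCZd r x (hw _)) hF', fun U => ?_⟩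
      rw [key U, twistTrace_option_none σ hnone, ContinuousMap.mul_apply, hF'U, loopCZd_apply]
    · set b₀ := Equiv.removeNone σ.symm a₀ with hb₀
      let w' : Fin p → Word d :=
        Function.update (fun a => w (e.symm (some a))) b₀ (w (e.symm (some b₀)) ++ w (e.symm none))
      have hw' : ∀ a, Word.endpointZd x (w' a) = x := by
        intro a
        by_cases ha : a = b₀
        · subst ha
          simp only [w', Function.update_self, Word.endpointZd_append, hw]
        · simp only [w', Function.update_of_ne ha, hw]
      obtain ⟨F', hF', hF'U⟩ := ih (Equiv.removeNone σ) w' hw'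
      refine ⟨F', hF', fun U => ?_⟩
      rw [key U, twistTrace_option_some σ hnone, hF'U, ← hb₀]
      congr 1
      funext a
      by_cases ha : a = b₀
      · rw [ha, Function.update_self]
        simp only [w', Function.update_self]
        exact rho_wordHolonomyZd_append_of_closed r U x (hw (e.symm (some b₀))) (w (e.symm none))
      · rw [Function.update_of_ne ha]
        simp only [w', Function.update_of_ne ha]

end Loops

end Summit.QuantumFields.GaugeBoot

end
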